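import Literature.Computability.QuantumComplexity.GluedTreesThm9Final
import Literature.Computability.Cryptography.ObfuscatedGluedTrees

/-!
# `WbwObfuscatedGluedTrees` (stmt-QuantumAdvantage-2340) — line `knowledge-of-walk-split`, STAGE 5: vocabulary of the
# IDEAL-MODEL (black-box) soundness audit of the landed generator `obfuscatedGluedTreesGen`

Definitions file (no hardness asserted; no theorem content beyond unfolding / well-formedness lemmas) for stage 5
of the line `knowledge-of-walk-split` of the INFORMAL crux `WbwObfuscatedGluedTrees` (route `Theses/WhiteBoxWalk`;
lead prover-line-stmt-QuantumAdvantage-2340-c4-0).  Stages 1–4 reduced the crux, by best-possible-obfuscation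
transfer, to `ClearHardness` / `ResidualExists` ("does ANY admissible presentation of the neighbour circuit `N_K` of
the obfuscated glued trees hide the EXIT from classical white-box walkers?").  Every such statement presupposes that
the INSTANCE FORMAT of the generator (`Literature/Computability/Cryptography/ObfuscatedGluedTrees.lean`: `N`-bit SIV
names `name_k(v) = τ ++ (label v ⊕ F_{k₂}(τ))`, `τ = F_{k₁}(label v)`, a random entrance name, sorted adjacency
lists, the all-invalid answer on non-names, bitwise access `nbrBit`) is sound against BLACK-BOX walkers — the
regime in which Childs et al. (2003), Theorem 9 (tree: `ChildsEtAl2003_thm9_holds`, for `2d`-bit uniformly random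
names with `name(ENTRANCE) = 0^{2d}`) is the only hardness supply (Disproof.lean §4, "the black-box supply").
Stage 5 proves that soundness in the IDEAL model, where the two PRF instances of the naming are replaced by
uniformly random function tables and the keyed Feistel cycle by a uniformly random cycle datum.  This file is its
vocabulary:

* §1 the `N`-bit traversal game of a deterministic transcript algorithm `M : OracleAlg β` (computationally
  unbounded, advice `x`) against the tree's string oracle `GluedTrees.strOracle σ ν` for an ARBITRARY name length
  `N` and an arbitrary injective naming `ν : Vertex d ↪ {0,1}^N`, the algorithm being handed `name(ENTRANCE)`:
  `FindsExitN`, `findProbN` (uniform cycle datum, uniform injective naming);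
* §2 the ideal SIV naming `sivNaming T Mk` built from a TAG TABLE `T : {0,1}^{2d+3} → {0,1}^μ` and a MASK TABLE
  `Mk : {0,1}^μ → {0,1}^{2d+3}` (`name(v) = T(label v) ++ (label v ⊕ Mk (T (label v)))`, injective for ALL tables,
  exactly as `vname_injective`), the event `TagDistinct` (pairwise distinct `μ`-bit prefixes), the slack
  `tagSlack d μ = C(|V(G'_d)|, 2) / 2^μ`, and the tables `tagTableOf` / `maskTableOf` read off a PRF scheme and two
  keys — the generator's own naming `naming P μ k₁ k₂ d` IS `sivNaming (tagTableOf P μ k₁ d) (maskTableOf P μ k₂ d)`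
  (proved in stage 5), so the ideal model idealises exactly these two tables;
* §3 the BIT ORACLE `bitOracle σ ν` of an instance — the functionality `nbrBit σ ν` of the shipped circuit as a
  string oracle (one output bit per query `(a, b) ∈ {0,1}^{2N}`) — and the success event / probability of a
  black-box walker that must OUTPUT a string with `name(EXIT)` as a prefix (`BitSuccess`, `sivSuccessProb`: uniform
  cycle datum, uniform tag and mask tables), the ideal-model rendering of clause (C)'s success event
  `{y | ans s <+: y}`.

[folklore] modelling conventions of the route; objects: ChildsEtAl2003 §2 and §4 Game 1 (names, oracle, winning
condition), Goldreich2004FoC2 Constructions 5.3.9 / 5.4.19 (SIV naming), BarakEtAl2012 Def. 2.2 (black-box access to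
the functionality of an obfuscated circuit).
-/

set_option linter.dupNamespace false

noncomputable section

namespace Summit.QuantumAdvantage.QuantumAdvantage.Theorems.WbwObfuscatedGluedTrees.KnowledgeOfWalk.BlackBox

open Literature.Computability.Complexity Literature.Computability.QuantumComplexity
open Literature.Computability.QuantumComplexity.GluedTrees
open Literature.Computability.Cryptography Literature.Computability.Cryptography.ObfuscatedGluedTrees

variable {d N : ℕ}

/-! ## §1 The `N`-bit traversal game -/

/-- The injective namings of the vertices of `G'_d` by `N`-bit strings (no constraint on `name(ENTRANCE)`).
[cite: ChildsEtAl2003, §2] -/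
abbrev NamingN (d N : ℕ) : Type := Vertex d ↪ (Fin N → Bool)

/-- The outcome space of the `N`-bit game: a cycle datum and an `N`-bit naming (both uniform). [cite: ChildsEtAl2003, §4 Game 1] -/
abbrev OutcomeN (d N : ℕ) : Type := CycleDatum d × NamingN d N

/-- The deterministic transcript algorithm `M` with advice `x`, handed `x ++ name(ENTRANCE)` as its input and run
for `t` rounds against the string oracle of the outcome `(σ, ν)`, **finds the EXIT**: `name(EXIT)` is one of its
(at most `t`) queries. The `N`-bit, random-entrance-name analogue of `GluedTrees.FindsExit` (the winning
condition of ChildsEtAl2003 §4 Game 1). [folklore] -/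
def FindsExitN {β : Type} (M : OracleAlg β) (x : List Bool) (t : ℕ) (ω : OutcomeN d N) : Prop :=
  List.ofFn (ω.2 (GluedTrees.exit d)) ∈
    M.queries (strOracle ω.1 ω.2) t (x ++ List.ofFn (ω.2 (entrance d)))

/-- Finding the EXIT is a decidable event. [folklore] -/
instance {β : Type} (M : OracleAlg β) (x : List Bool) (t : ℕ) :
    DecidablePred (FindsExitN (d := d) (N := N) M x t) :=
  fun ω => by unfold FindsExitN; infer_instance

/-- The success probability of `(M, x)` within `t` rounds in the `N`-bit game: the fraction of outcomes (uniform
cycle datum, uniform injective `N`-bit naming) on which it finds the EXIT. [cite: ChildsEtAl2003, §4 Game 1] -/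
def findProbN (d N : ℕ) {β : Type} (M : OracleAlg β) (x : List Bool) (t : ℕ) : ℝ :=
  ((Finset.univ.filter (FindsExitN (d := d) (N := N) M x t)).card : ℝ) / Fintype.card (OutcomeN d N)

/-- The success probability is non-negative. [folklore] -/
theorem findProbN_nonneg (d N : ℕ) {β : Type} (M : OracleAlg β) (x : List Bool) (t : ℕ) :
    0 ≤ findProbN d N M x t := by
  unfold findProbN; positivity

/-- The success probability is at most `1`. [folklore] -/
theorem findProbN_le_one (d N : ℕ) {β : Type} (M : OracleAlg β) (x : List Bool) (t : ℕ) :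
    findProbN d N M x t ≤ 1 := by
  unfold findProbN
  refine div_le_one_of_le₀ ?_ (Nat.cast_nonneg _)
  exact_mod_cast (Finset.card_filter_le _ _).trans (Finset.card_univ (α := OutcomeN d N)).le

/-! ## §2 The ideal SIV naming: tag table and mask table -/

/-- The label of a vertex as a bit VECTOR of length `labelLen d = 2d + 3` (the list `label d v` re-indexed).
[cite: ChildsEtAl2003, §2] -/
def labelVec (d : ℕ) (v : Vertex d) : Fin (labelLen d) → Bool :=
  fun i => (label d v).get (i.cast (length_label v).symm)

/-- Listing the label vector gives back the label. [folklore] -/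
theorem ofFn_labelVec (v : Vertex d) : List.ofFn (labelVec d v) = label d v := by
  apply List.ext_get (by simp) fun i h₁ h₂ => ?_
  simp [labelVec]

/-- The label vector is an injective code of the vertices. [folklore] -/
theorem labelVec_injective (d : ℕ) : Function.Injective (labelVec d) := fun u v h =>
  label_injective d (by rw [← ofFn_labelVec, ← ofFn_labelVec, h])

/-- Bitwise exclusive or of two bit vectors of the same length. [folklore] -/
def xorVec {m : ℕ} (a b : Fin m → Bool) : Fin m → Bool := fun i => xor (a i) (b i)

/-- Masking twice with the same mask is the identity. [folklore] -/
@[simp] theorem xorVec_xorVec_cancel {m : ℕ} (a b : Fin m → Bool) : xorVec (xorVec a b) b = a := by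
  funext i; simp [xorVec]

/-- A TAG TABLE: a function `{0,1}^{2d+3} → {0,1}^μ` (the ideal stand-in for `F_{k₁}` on labels). [folklore] -/
abbrev TagTable (d μ : ℕ) : Type := (Fin (labelLen d) → Bool) → (Fin μ → Bool)

/-- A MASK TABLE: a function `{0,1}^μ → {0,1}^{2d+3}` (the ideal stand-in for `F_{k₂}` on tags, truncated to
the label length). [folklore] -/
abbrev MaskTable (d μ : ℕ) : Type := (Fin μ → Bool) → (Fin (labelLen d) → Bool)

variable {μ : ℕ}

/-- **The SIV name of a vertex from the tables**: `name(v) = T(label v) ++ (label v ⊕ Mk (T (label v)))`, a bit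
vector of length `nameLen μ d = μ + (2d + 3)`. [cite: Goldreich2004FoC2, Constructions 5.3.9 and 5.4.19] -/
def sivName (T : TagTable d μ) (Mk : MaskTable d μ) (v : Vertex d) : Fin (nameLen μ d) → Bool :=
  Fin.append (T (labelVec d v)) (xorVec (labelVec d v) (Mk (T (labelVec d v))))

/-- The `μ`-bit prefix (the tag part) of a name of length `nameLen μ d`. [folklore] -/
def tagPart (a : Fin (nameLen μ d) → Bool) : Fin μ → Bool := fun i => a (Fin.castAdd (labelLen d) i)

/-- The `(2d+3)`-bit suffix (the masked-label part) of a name of length `nameLen μ d`. [folklore] -/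
def bodyPart (a : Fin (nameLen μ d) → Bool) : Fin (labelLen d) → Bool := fun i => a (Fin.natAdd μ i)

/-- The tag part of a SIV name is the tag of the label. [folklore] -/
@[simp] theorem tagPart_sivName (T : TagTable d μ) (Mk : MaskTable d μ) (v : Vertex d) :
    tagPart (sivName T Mk v) = T (labelVec d v) := by
  funext i; simp [tagPart, sivName]

/-- The body part of a SIV name is the masked label. [folklore] -/
@[simp] theorem bodyPart_sivName (T : TagTable d μ) (Mk : MaskTable d μ) (v : Vertex d) :
    bodyPart (sivName T Mk v) = xorVec (labelVec d v) (Mk (T (labelVec d v))) := by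
  funext i; simp [bodyPart, sivName]

/-- SIV names are injective for EVERY pair of tables (the tag travels with the name; a fixed mask is injective) —
the ideal twin of `vname_injective`. [folklore] -/
theorem sivName_injective (T : TagTable d μ) (Mk : MaskTable d μ) : Function.Injective (sivName T Mk) := by
  intro u v h
  have ht : T (labelVec d u) = T (labelVec d v) := by
    rw [← tagPart_sivName T Mk u, ← tagPart_sivName T Mk v, h]
  have hb := congrArg bodyPart h
  rw [bodyPart_sivName, bodyPart_sivName, ht] at hb
  have := congrArg (fun a => xorVec a (Mk (T (labelVec d v)))) hb
  simp only [xorVec_xorVec_cancel] at this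
  exact labelVec_injective d this

/-- **The ideal SIV naming** `V(G'_d) ↪ {0,1}^{nameLen μ d}` built from a tag table and a mask table.
[cite: Goldreich2004FoC2, Constructions 5.3.9 and 5.4.19] -/
def sivNaming (T : TagTable d μ) (Mk : MaskTable d μ) : NamingN d (nameLen μ d) :=
  ⟨sivName T Mk, sivName_injective T Mk⟩

/-- Unfolding: the ideal SIV naming applied to a vertex. [folklore] -/
@[simp] theorem sivNaming_apply (T : TagTable d μ) (Mk : MaskTable d μ) (v : Vertex d) :
    sivNaming T Mk v = sivName T Mk v := rfl

/-- **Tag-distinctness** of a naming by `nameLen μ d`-bit strings: distinct vertices have distinct `μ`-bit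
prefixes (the good event outside which the SIV structure could show). [folklore] -/
def TagDistinct (ν : NamingN d (nameLen μ d)) : Prop :=
  ∀ u v : Vertex d, tagPart (ν u) = tagPart (ν v) → u = v

/-- Tag-distinctness is decidable. [folklore] -/
instance (ν : NamingN d (nameLen μ d)) : Decidable (TagDistinct ν) := by
  unfold TagDistinct; infer_instance

/-- **The tag slack** `C(|V(G'_d)|, 2) / 2^μ`: the union bound on a prefix collision among the
`|V(G'_d)| = 2^{d+2} − 2` names, for `μ`-bit prefixes. [folklore] -/
def tagSlack (d μ : ℕ) : ℝ := ((Fintype.card (Vertex d)).choose 2 : ℝ) / 2 ^ μ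

/-- The tag slack is non-negative. [folklore] -/
theorem tagSlack_nonneg (d μ : ℕ) : 0 ≤ tagSlack d μ := by
  unfold tagSlack; positivity

/-- **The tag table of a PRF scheme and a key**: `ℓ ↦ F_{k₁}(ℓ)` at parameter `μ`, fitted to `μ` bits (the
generator's `tag`), as a table on label vectors. [folklore] -/
def tagTableOf (P : PuncturablePRFScheme) (μ : ℕ) (k₁ : List Bool) (d : ℕ) : TagTable d μ :=
  fun ℓ i => (prf P μ k₁ μ (List.ofFn ℓ)).get (i.cast (length_prf P μ k₁ μ _).symm)

/-- **The mask table of a PRF scheme and a key**: `τ ↦ F_{k₂}(τ)` at parameter `μ`, fitted to `2d + 3` bits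
(the generator's mask), as a table on tag vectors. [folklore] -/
def maskTableOf (P : PuncturablePRFScheme) (μ : ℕ) (k₂ : List Bool) (d : ℕ) : MaskTable d μ :=
  fun τ i => (prf P μ k₂ (labelLen d) (List.ofFn τ)).get (i.cast (length_prf P μ k₂ (labelLen d) _).symm)

/-! ## §3 Black-box access to the instance: the bit oracle and the success event -/

/-- **The bit oracle of an instance** `(σ, ν)`: the functionality `nbrBit σ ν` of the shipped neighbour circuit as
a string oracle — a query of length `2N` (a name `a` followed by an output position `b`) is answered by the one bit
`nbrBit σ ν (a, b)`, any other query by `[]`. Black-box access to the obfuscated circuit is oracle access to this.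
[cite: BarakEtAl2012, Def. 2.2] -/
def bitOracle (σ : CycleDatum d) (ν : NamingN d N) : Oracle := fun q =>
  if h : q.length = N + N then [nbrBit σ ν fun i => q.get (i.cast h.symm)] else []

/-- **Black-box success**: the transcript algorithm `M` (output type `List Bool`) with advice `x`, run for `t`
rounds against the bit oracle of `(σ, ν)` on input `x ++ name(ENTRANCE)`, OUTPUTS a string with `name(EXIT)` as a
prefix — the ideal-model rendering of clause (C)'s success event `{y | ans s <+: y}`. [folklore] -/
def BitSuccess (M : OracleAlg (List Bool)) (x : List Bool) (t : ℕ) (σ : CycleDatum d) (ν : NamingN d N) : Prop :=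
  ∃ y, M.run (bitOracle σ ν) t (x ++ List.ofFn (ν (entrance d))) = some y ∧ List.ofFn (ν (GluedTrees.exit d)) <+: y

/-- The ideal sample space of stage 5: a cycle datum, a tag table and a mask table (all uniform). [folklore] -/
abbrev SivSpace (d μ : ℕ) : Type := CycleDatum d × TagTable d μ × MaskTable d μ

open Classical in
/-- **The ideal-model success probability**: the fraction of `(σ, T, Mk)` (uniform cycle datum, uniform tag and
mask tables) on which `(M, x)` succeeds within `t` rounds against the bit oracle of `(σ, sivNaming T Mk)`.
[cite: ChildsEtAl2003, §4 Game 1] -/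
def sivSuccessProb (d μ : ℕ) (M : OracleAlg (List Bool)) (x : List Bool) (t : ℕ) : ℝ :=
  ((Finset.univ.filter fun p : SivSpace d μ => BitSuccess M x t p.1 (sivNaming p.2.1 p.2.2)).card : ℝ) /
    Fintype.card (SivSpace d μ)

/-- The ideal-model success probability is non-negative. [folklore] -/
theorem sivSuccessProb_nonneg (d μ : ℕ) (M : OracleAlg (List Bool)) (x : List Bool) (t : ℕ) :
    0 ≤ sivSuccessProb d μ M x t := by
  unfold sivSuccessProb; positivity

/-- The ideal-model success probability is at most `1`. [folklore] -/
theorem sivSuccessProb_le_one (d μ : ℕ) (M : OracleAlg (List Bool)) (x : List Bool) (t : ℕ) :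
    sivSuccessProb d μ M x t ≤ 1 := by
  classical
  unfold sivSuccessProb
  refine div_le_one_of_le₀ ?_ (Nat.cast_nonneg _)
  exact_mod_cast (Finset.card_filter_le _ _).trans (Finset.card_univ (α := SivSpace d μ)).le

/-- Registered helper stub of crux stmt-QuantumAdvantage-2340 (`ledger workitem stub-add`; the gate admits a
`--supports` file only if it proves a registered stub): the tag part of an ideal SIV name is the tag of the label,
for every pair of tables. [folklore] -/
theorem toolkit_bbVocabulary :
    ∀ (d μ : ℕ) (T : TagTable d μ) (Mk : MaskTable d μ) (v : Vertex d), tagPart (sivNaming T Mk v) = T (labelVec d v) :=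
  fun _ _ T Mk v => tagPart_sivName T Mk v

end Summit.QuantumAdvantage.QuantumAdvantage.Theorems.WbwObfuscatedGluedTrees.KnowledgeOfWalk.BlackBox

end
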